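import Summits.BirchSwinnertonDyer.BirchSwinnertonDyer.Theorems.SchneiderFreeAdditiveX3TateLineCharacter
import Summits.BirchSwinnertonDyer.BirchSwinnertonDyer.Theorems.SchneiderFreeAdditiveX3LocalTowerTorsionFiniteOfLine
import Summits.BirchSwinnertonDyer.Rank1Residual.Additive.SplitMultiplicativeBaseChange
import Summits.BirchSwinnertonDyer.Rank1Residual.X11b.BDPRouteLocalKernelAtPPadic
import Literature.NumberTheory.EllipticCurves.TateCurve.NumberFieldUniformization
import Literature.NumberTheory.EllipticCurves.AnticyclotomicLocalNormResidueSymbolProofs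
import HarnessLib

/-!
# Crux 4 `BSDpOnCellC` (stmt-BirchSwinnertonDyer-19034), line b1, stub `stub_ctlOrSwitch` — CTL-loc,
# the local input Fin_v at a SPLIT multiplicative prime: `E(K_{∞,w})[p^∞]` is finite (indeed
# `= E(K_𝔭)[p^∞]` up to the Tate line) along the anticyclotomic tower (cell `bsd-eis`, seat
# `bsd-eis-k5-c4` g5; THEOREMS ONLY, `--supports stmt-BirchSwinnertonDyer-19034`)

HONEST FRAMING (cell `bsd-eis`, run/shared/lean/pub/bsd-eis/): theorems only; nothing booked; X2
stays CONSTRUCTION-SHAPED; no label or count moves; closes nothing by itself. NO cite-only input: the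
Tate uniformisation (Silverman *ATAEC* V.5.3, `Silverman1994_thmV53_tateUniformisation_holds`) and the
local norm residue symbol of `π²/p^h` (`ZpExtension.exists_isFrobPow_mem_kerSubgroup_of_isAnticyclotomic_holds`)
are tree THEOREMS.

## Why this file (k5-c4-MEMO-2 §0 C3 (I1-loc); companion of `…CtlLocOfFinV.lean`)

`splitControlOnTree_of_cellC_of_noKTorsion_of_finV` (this seat) proves the anticyclotomic control
theorem `X2.SplitControlOnTree` at a split Eisenstein `p ‖ N` WITH local `p`-torsion from `E(K)[p] = 0`
and Fin_v = `SchneiderFreeControlAtoms.LocalTowerTorsionFiniteAt (E_K) p κ 𝔭`: finiteness of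
`E(K̄)[p^∞]^{D_𝔭 ⊓ ker κ} = E(K_{∞,w})[p^∞]` (Jetchev–Skinner–Wan 2017 Prop. 3.3.4 Case 3(b): "`#ker r_v
= #H⁰(K_v, W)`" needs "`T^∨_{P_v}` finite"). The `bsd-schneider-ideate` cell proved Fin_v on its
ADDITIVE cells through a canonical line modulo which some element of `D_𝔭` acts as `−1` (the ramified
quadratic twist; `localTowerTorsionFiniteAt_of_line`). At a SPLIT multiplicative `p` there is no such
element — `D_𝔭` acts TRIVIALLY on `E[p^∞]/C`, `C ≅ μ_{p^∞}` the Tate line — and the argument is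
different (and gives more):

* §1 **`localTowerTorsionFiniteAt_of_trivQuotLine`** (any elliptic `E/K`, any `ℤ_p`-extension `κ`, any
  finite `𝔭`): if `C ≤ E[p^∞]` has `#C[p] ≤ p`, `D_𝔭` acts trivially on `E[p^∞]/C`
  (`d • m − m ∈ C`), `E[p^∞]^{D_𝔭}` is finite and some `g ∈ D_𝔭 ⊓ ker κ` moves some point of `C`, then
  `B = E[p^∞]^{D_𝔭 ⊓ ker κ}` is finite. Proof: `C ∩ B` is a PROPER `D_𝔭 ⊓ ker κ`-fixed subgroup of the
  cocyclic `C`, hence finite (door-c5's `le_or_finite_of_card_layer_le`); for a topological generator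
  `γ_v` of `D_𝔭` modulo `D_𝔭 ⊓ ker κ` (tree `exists_mem_decomp_generate`) the map `γ_v − 1 : B → B`
  (tree `decompSubOne`) lands in `C ∩ B` (trivial quotient action) and has kernel `⊆ E[p^∞]^{D_𝔭}`
  (tree `smul_eq_of_decompSubOne_eq_zero`), so `#B ≤ #E[p^∞]^{D_𝔭} · #(C ∩ B)`.
* §2 `tateDatum_smul_sub_mem_of_equivariant` — for a Γ_{K_v}-EQUIVARIANT Tate parametrisation (the
  split case) `D_v` acts trivially on `E[p^∞]/C_v` (the tree's `tateDatum_htriv`, inertia → all of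
  `D_v`).
* §3 **`localTowerTorsionFiniteAt_of_hasSplitMultiplicativeReductionAtPrime`** — Fin_v for `E/ℚ` with
  SPLIT multiplicative reduction at the odd prime `p`, over every imaginary quadratic `K` with `p`
  split, every ANTICYCLOTOMIC `κ` and every `𝔭 ∣ p`: the Tate line of `E_K` at `𝔭` (X2
  `tateDatum` of the parametrisation supplied by `Silverman1994_thmV53_tateUniformisation_holds`, with its
  character `χ_p` by door-c2's `tateDatum_lineCharacter` at `t = 1`, clauses by `tateDatum_lineClauses`)
  and the mover `σ₀ = (π²/p^h, K_𝔭^{ab}/K_𝔭)` of the tree theorem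
  `exists_isFrobPow_mem_kerSubgroup_of_isAnticyclotomic_holds` — if `σ₀` fixed `C` then `χ_p(σ₀) = 1`,
  i.e. `φ(π)² = p^{2h}` in `ℤ_p`, excluded by door-c5's weight lemma `ne_of_span_eq_pow` (`π² ∉ ℚ`) —
  fed to §1, with `E_K[p^∞]^{D_𝔭} ↪ E(K_𝔭)[p^∞] ≅ E(ℚ_p)[p^∞]` finite (X11b
  `natCard_fixedPoints_decomp_le_natCard_primaryComponent`).

With `…CtlLocOfFinV` this discharges the last hypothesis of `X2.SplitControlOnTree` at the chain-end
curves of `stub_ctlOrSwitch` (next file: composition with the chain-end lemma).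

References: [JetchevSkinnerWan2017] §3.3 Prop. 3.3.4 Case 3(b), Remark 3.3.5 (arXiv:1512.06894 p. 13);
[GreenbergLNM1716] §3 Lemma 3.3 (p. 87); [GreenbergVatsal2000] §2 pp. 14–15 (`C ≅ μ_{p^∞}`,
`D = A/C ≅ ℚ_p/ℤ_p`); [SilvermanATAEC1994] V.3.1, V.5.3; [Brink2007] Cor. 1; [CasselsFrohlichANT1967]
VII §6; k5-c4-MEMO-2 (C3 (I1-loc)).
-/

set_option autoImplicit false
-- the route's Theorems namespace `Summit.BirchSwinnertonDyer.BirchSwinnertonDyer.Theorems` (summit = problem) trips the linter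
set_option linter.dupNamespace false

noncomputable section

open scoped Classical

open WeierstrassCurve NumberField IsDedekindDomain Field Literature.NumberTheory.EllipticCurves
  Literature.NumberTheory.EllipticCurves.GreenbergSelmer
  Literature.NumberTheory.GaloisRepresentations
  Summit.BirchSwinnertonDyer.Rank1Residual
  Summit.BirchSwinnertonDyer.Rank1Residual.X11b
  Summit.BirchSwinnertonDyer.Rank1Residual.X11b.AcSelmer
  Summit.BirchSwinnertonDyer.Rank1Residual.X2.GreenbergVatsalTateDatum
  Summit.BirchSwinnertonDyer.Rank1Residual.X2.GreenbergVatsalTateDatumSign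
  Summit.BirchSwinnertonDyer.BirchSwinnertonDyer.Theorems.SchneiderFreeControlAtoms
  Summit.BirchSwinnertonDyer.BirchSwinnertonDyer.Theorems.SchneiderFreeAdditiveX3
  Summit.Ventures.HodgeRepro2.T5DegreeOneNumberField

namespace Summit.BirchSwinnertonDyer.BirchSwinnertonDyer.Theorems.CtlLoc

/-! ## §1. Fin_v from a line with TRIVIAL quotient action and one moving element -/

section TrivQuot

variable {K : Type} [Field K] [NumberField K] (E : WeierstrassCurve K) [E.IsElliptic] (p : ℕ)
  [hp : Fact p.Prime] (κ : ZpExtension K p) (𝔭 : HeightOneSpectrum (𝓞 K))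

/-- **Fin_v from a `D_𝔭`-stable line with trivial quotient action and one moving element of the local
tower group.** For an elliptic curve `E` over a number field `K`, a prime `p`, ANY `ℤ_p`-extension `κ`
and a finite place `𝔭` with `E(K̄)[p^∞]^{D_𝔭}` finite (always: `≅ E(K_𝔭)[p^∞]`): if `C ≤ E[p^∞]` has at
most `p` points killed by `p`, every `d ∈ D_𝔭` acts trivially on `E[p^∞]/C` (`d • m − m ∈ C`), and some
`g ∈ D_𝔭 ⊓ ker κ` moves some point of `C`, then `E(K̄)[p^∞]^{D_𝔭 ⊓ ker κ} = E(K_{∞,w})[p^∞]` is FINITE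
(`LocalTowerTorsionFiniteAt E p κ 𝔭`). Proof: with `B = E[p^∞]^{ker κ ⊓ D_𝔭}` and `γ_v ∈ D_𝔭` a
topological generator modulo `D_𝔭 ⊓ ker κ`, the endomorphism `γ_v − 1` of `B` takes values in `C ∩ B`
(trivial quotient action) — a proper fixed subgroup of the cocyclic `C`, hence finite — and its kernel
is `E[p^∞]^{D_𝔭}`; so `B` is finite. (Greenberg LNM 1716 p. 87: "the kernel of `γ_v − 1` acting on
`B_v` … is `E(F_v)_p`", here with the IMAGE controlled by the Tate line.)
[cite: GreenbergLNM1716, §3 Lemma 3.3 (proof, p. 87)]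
[cite: JetchevSkinnerWan2017, §3.3 Prop. 3.3.4 Case 3(b) (arXiv:1512.06894 p. 13)] -/
theorem localTowerTorsionFiniteAt_of_trivQuotLine (C : AddSubgroup (E.geomPrimaryTorsion p))
    (hC1 : Set.ncard {c : E.geomPrimaryTorsion p | c ∈ C ∧ p • c = 0} ≤ p)
    (hquot : ∀ d ∈ decomp 𝔭, ∀ m : E.geomPrimaryTorsion p, d • m - m ∈ C)
    (hmove : ∃ g ∈ decomp 𝔭 ⊓ κ.kerSubgroup, ∃ c ∈ C, g • c ≠ c)
    [hfix : Finite (FixedPoints.addSubgroup ↥(decomp 𝔭) (E.geomPrimaryTorsion p))] :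
    LocalTowerTorsionFiniteAt E p κ 𝔭 := by
  -- `B = E[p^∞]^{ker κ ⊓ D_𝔭}` and the generator `γ_v`
  set B := FixedPoints.addSubgroup ↥(κ.kerSubgroup ⊓ decomp 𝔭) (E.geomPrimaryTorsion p) with hB
  obtain ⟨g, hgen⟩ := exists_mem_decomp_generate κ 𝔭
  have hgD : (g : absoluteGaloisGroup K) ∈ decomp 𝔭 := (Subgroup.mem_inf.mp g.2).2
  set φ : B →+ B := decompSubOne κ (E.geomPrimaryTorsion p) (g : absoluteGaloisGroup K) hgD with hφ
  -- (1) `ker φ ↪ E[p^∞]^{D_𝔭}`, finite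
  let j : φ.ker → FixedPoints.addSubgroup ↥(decomp 𝔭) (E.geomPrimaryTorsion p) := fun b ↦
    ⟨((b : B) : E.geomPrimaryTorsion p), fun x ↦
      smul_eq_of_decompSubOne_eq_zero E p κ 𝔭 hgen (b : B) ((AddMonoidHom.mem_ker).mp b.2) x x.2⟩
  have hj : Function.Injective j := by
    intro a b hab
    apply Subtype.ext; apply Subtype.ext
    exact congrArg (fun z : FixedPoints.addSubgroup ↥(decomp 𝔭) (E.geomPrimaryTorsion p) ↦
      (z : E.geomPrimaryTorsion p)) hab
  haveI : Finite φ.ker := Finite.of_injective j hj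
  -- (2) `range φ ⊆ C ∩ B`, and `C ∩ B` is finite
  let CB : AddSubgroup (E.geomPrimaryTorsion p) :=
    { carrier := {m | m ∈ C ∧ ∀ x : ↥(κ.kerSubgroup ⊓ decomp 𝔭), x • m = m}
      add_mem' := fun {a b} ha hb ↦ ⟨C.add_mem ha.1 hb.1, fun x ↦ by rw [smul_add, ha.2 x, hb.2 x]⟩
      zero_mem' := ⟨C.zero_mem, fun x ↦ smul_zero _⟩
      neg_mem' := fun {a} ha ↦ ⟨C.neg_mem ha.1, fun x ↦ by rw [smul_neg, ha.2 x]⟩ }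
  have hCB_mem : ∀ m, m ∈ CB ↔ m ∈ C ∧ ∀ x : ↥(κ.kerSubgroup ⊓ decomp 𝔭), x • m = m := fun m ↦
    Iff.rfl
  have hCBle : CB ≤ C := fun m hm ↦ ((hCB_mem m).mp hm).1
  have htor : ∀ x : E.geomPrimaryTorsion p, ∃ k : ℕ, p ^ k • x = 0 := fun x ↦ by
    obtain ⟨k, hk⟩ := x.2
    exact ⟨k, Subtype.ext (by rw [AddSubgroupClass.coe_nsmul, hk]; rfl)⟩
  have hCBfin : (CB : Set (E.geomPrimaryTorsion p)).Finite := by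
    rcases le_or_finite_of_card_layer_le C CB hCBle htor
        (finite_setOf_geomPrimaryTorsion_pow_smul_eq_zero E hp.out.ne_zero) hC1 with h | h
    · -- `C ≤ CB`: every point of `C` is fixed by `ker κ ⊓ D_𝔭` — contradicts the mover
      obtain ⟨g₀, hg₀, c, hc, hne⟩ := hmove
      have hg₀' : g₀ ∈ κ.kerSubgroup ⊓ decomp 𝔭 :=
        Subgroup.mem_inf.mpr ⟨(Subgroup.mem_inf.mp hg₀).2, (Subgroup.mem_inf.mp hg₀).1⟩
      exact absurd (((hCB_mem c).mp (h hc)).2 ⟨g₀, hg₀'⟩) hne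
    · exact h
  haveI hCBfinite : Finite CB := hCBfin.to_subtype
  let r : φ.range → CB := fun y ↦ ⟨((y : B) : E.geomPrimaryTorsion p), by
    obtain ⟨b, hb⟩ := y.2
    rw [hCB_mem]
    refine ⟨?_, fun x ↦ (y : B).2 x⟩
    rw [← hb, hφ, coe_decompSubOne_apply]
    exact hquot _ hgD _⟩
  have hr : Function.Injective r := by
    intro a b hab
    apply Subtype.ext; apply Subtype.ext
    exact congrArg (fun z : CB ↦ (z : E.geomPrimaryTorsion p)) hab
  haveI : Finite φ.range := Finite.of_injective r hr
  -- (3) `B` is finite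
  haveI : Finite (B ⧸ φ.ker) :=
    Finite.of_equiv _ (QuotientAddGroup.quotientKerEquivRange φ).toEquiv.symm
  haveI hBfin : Finite B :=
    Finite.of_equiv _ (AddSubgroup.addGroupEquivQuotientProdAddSubgroup (s := φ.ker)).symm
  -- transport `ker κ ⊓ D_𝔭` ↔ `D_𝔭 ⊓ ker κ`
  have hsub : (FixedPoints.addSubgroup ↥(decomp 𝔭 ⊓ κ.kerSubgroup) (E.geomPrimaryTorsion p) :
      Set (E.geomPrimaryTorsion p)) ⊆ (B : Set (E.geomPrimaryTorsion p)) := by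
    intro m hm x
    exact (FixedPoints.mem_addSubgroup _ _ m).mp hm
      ⟨x.1, Subgroup.mem_inf.mpr ⟨(Subgroup.mem_inf.mp x.2).2, (Subgroup.mem_inf.mp x.2).1⟩⟩
  exact (Set.toFinite (B : Set (E.geomPrimaryTorsion p))).subset hsub

end TrivQuot

/-! ## §2. At a SPLIT multiplicative place `D_v` acts trivially on `E[p^∞]/C_v` -/

section TateQuot

variable {K : Type} [Field K] [NumberField K] (W : WeierstrassCurve K) (p : ℕ) [hp : Fact p.Prime]
  {v : HeightOneSpectrum (𝓞 K)}
  (Φ : Additive (AlgebraicClosure (v.adicCompletion K))ˣ →+ localPoints W (v.adicCompletion K))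
  (hΦ : ∀ (σ : absoluteGaloisGroup (v.adicCompletion K))
    (u : (AlgebraicClosure (v.adicCompletion K))ˣ),
    σ • Φ (Additive.ofMul u) = Φ (Additive.ofMul (Units.map
      (Field.absoluteGaloisGroup.toAlgEquiv (v.adicCompletion K) σ :
        AlgebraicClosure (v.adicCompletion K) →* AlgebraicClosure (v.adicCompletion K)) u)) ∨
    σ • Φ (Additive.ofMul u) = -Φ (Additive.ofMul (Units.map
      (Field.absoluteGaloisGroup.toAlgEquiv (v.adicCompletion K) σ :
        AlgebraicClosure (v.adicCompletion K) →* AlgebraicClosure (v.adicCompletion K)) u)))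
  (hsurj : Function.Surjective Φ) {q : v.adicCompletion K}
  (hker : ∀ u : (AlgebraicClosure (v.adicCompletion K))ˣ, Φ (Additive.ofMul u) = 0 →
    ∃ a : ℤ, (u : AlgebraicClosure (v.adicCompletion K)) =
      algebraMap (v.adicCompletion K) (AlgebraicClosure (v.adicCompletion K)) q ^ a)
  (hΦσ : ∀ (σ : absoluteGaloisGroup (v.adicCompletion K))
    (u : (AlgebraicClosure (v.adicCompletion K))ˣ),
    σ • Φ (Additive.ofMul u) = Φ (Additive.ofMul (Units.map
      (Field.absoluteGaloisGroup.toAlgEquiv (v.adicCompletion K) σ :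
        AlgebraicClosure (v.adicCompletion K) →* AlgebraicClosure (v.adicCompletion K)) u)))

include hsurj hker hΦσ in
/-- **In the SPLIT case the whole decomposition group acts trivially on `D = E[p^∞]/C_v`**
("`D ≅ ℚ_p/ℤ_p` is a trivial `G_{ℚ_p}`-module", Greenberg–Vatsal p. 14): for every `x ∈ D_v` and
`m ∈ E[p^∞]`, `x•m − m ∈ C_v`. The tree's `tateDatum_htriv` VERBATIM with the inertia group replaced by
`D_v`, which is all its proof used once the parametrisation is `Γ_{K_v}`-equivariant for every `σ`
(Silverman V.5.3 (b): `E ≅ E_q` over `K_v` at a split place): `ι m = Φ(u)`, `u^{p^k} = q^a`,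
`x•(ι m) − ι m = Φ(σu/u)` and `(σu/u)^{p^k} = σ(q^a)/q^a = 1`.
[cite: GreenbergVatsal2000, §2 pp. 14–15] [cite: SilvermanATAEC1994, Ch. V Thm. 3.1 (c),(d) and Thm. 5.3 (b)] -/
theorem tateDatum_smul_sub_mem_of_equivariant :
    ∀ x ∈ decomp v, ∀ m : W.geomPrimaryTorsion p, x • m - m ∈ (tateDatum W p Φ hΦ).plus := by
  intro x hx m
  obtain ⟨σ, rfl⟩ := (mem_decomp_iff v x).1 hx
  obtain ⟨u, hu⟩ := hsurj (pointsMap W (v.adicCompletion K) (m : W.geomPoints))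
  obtain ⟨u', rfl⟩ : ∃ u' : (AlgebraicClosure (v.adicCompletion K))ˣ, Additive.ofMul u' = u :=
    ⟨Additive.toMul u, ofMul_toMul u⟩
  obtain ⟨k, hk⟩ := (AddCommGroup.mem_primaryComponent).1 m.2
  have h0 : Φ (Additive.ofMul (u' ^ p ^ k)) = 0 := by
    rw [ofMul_pow, map_nsmul, hu, ← map_nsmul, hk, map_zero]
  obtain ⟨a, ha⟩ := hker _ h0
  rw [mem_tateDatum_plus_iff]
  refine ⟨Units.map (Field.absoluteGaloisGroup.toAlgEquiv (v.adicCompletion K) σ :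
      AlgebraicClosure (v.adicCompletion K) →* AlgebraicClosure (v.adicCompletion K)) u' * u'⁻¹,
    ?_, ?_⟩
  · refine isOfFinOrder_iff_pow_eq_one.2 ⟨p ^ k, pow_pos hp.out.pos k, ?_⟩
    rw [mul_pow, inv_pow, ← map_pow, mul_inv_eq_one]
    ext
    rw [Units.coe_map, MonoidHom.coe_coe, ha, map_zpow₀, AlgEquiv.commutes]
  · rw [ofMul_mul, ofMul_inv, map_add, map_neg, ← hΦσ σ u', hu, AddSubgroupClass.coe_sub,
      map_sub, primaryComponent.coe_smul, ← sub_eq_add_neg]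
    congr 1
    exact (pointsMap_smul W (v.adicCompletion K) σ (m : W.geomPoints)).symm

end TateQuot

/-! ## §3. Fin_v at a split multiplicative prime of `E/ℚ`, along the anticyclotomic tower -/

section Split

variable (W : WeierstrassCurve ℚ) [W.IsElliptic] [W.IsGloballyMinimal] {p : ℕ} [hp : Fact p.Prime]
  {K : Type} [Field K] [NumberField K]

/-- **Fin_v at a SPLIT multiplicative prime.** For `E/ℚ` globally minimal with split multiplicative
reduction at the odd prime `p`, an imaginary quadratic `K` in which `p` splits, an ANTICYCLOTOMIC
`ℤ_p`-extension `κ` of `K` and a prime `𝔭 ∣ p` of `K`: `E(K̄)[p^∞]^{D_𝔭 ⊓ ker κ} = E(K_{∞,w})[p^∞]` is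
finite (`LocalTowerTorsionFiniteAt (E_K) p κ 𝔭`). Ingredients, all tree theorems: the Tate
parametrisation of `E_K` at `𝔭` (`Silverman1994_thmV53_tateUniformisation_holds`; `E_K` is split
multiplicative at `𝔭`, `Additive.hasSplitMultiplicativeReductionAt_baseChange_of_…`), its line
`C = C_𝔭` (`tateDatum`: `#C[p] ≤ p`, points of every order, character `χ_p` — door-c2's
`tateDatum_lineClauses` / `tateDatum_lineCharacter` at `t = 1`), trivial quotient action (§2), the
local norm residue symbol `σ₀` of `π²/p^h` (`exists_isFrobPow_mem_kerSubgroup_of_isAnticyclotomic_holds`: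
`res σ₀ ∈ D_𝔭 ⊓ ker κ`, `χ_p(σ₀)·φ(π)² = p^{2h}`) — which MOVES a point of `C`, since otherwise
`χ_p(σ₀) ≡ 1 (mod p^k)` for all `k` and `φ(π)² = p^{2h}`, excluded by door-c5's `ne_of_span_eq_pow` — and
`E_K[p^∞]^{D_𝔭} ↪ E(K_𝔭)[p^∞] ≅ E(ℚ_p)[p^∞]` finite; then §1.
[cite: JetchevSkinnerWan2017, §3.3 Prop. 3.3.4 Case 3(b) (arXiv:1512.06894 p. 13)]
[cite: GreenbergVatsal2000, §2 pp. 14–15] [cite: SilvermanATAEC1994, Ch. V Thm. 5.3]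
[cite: Brink2007, Cor. 1 (p. 2136)] -/
theorem localTowerTorsionFiniteAt_of_hasSplitMultiplicativeReductionAtPrime (hp2 : p ≠ 2)
    (hsplitW : W.HasSplitMultiplicativeReductionAtPrime p)
    (hK : IsImaginaryQuadratic K) (hsplit : SplitsIn K p) (κ : ZpExtension K p)
    (hκ : κ.IsAnticyclotomic) (𝔭 : HeightOneSpectrum (𝓞 K)) (h𝔭 : ((p : ℕ) : 𝓞 K) ∈ 𝔭.asIdeal) :
    LocalTowerTorsionFiniteAt (W.baseChange K) p κ 𝔭 := by
  haveI hEK : (W.baseChange K).IsElliptic := by rw [baseChange]; infer_instance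
  have h2 : Module.finrank ℚ K = 2 := hK.1
  obtain ⟨he, hf⟩ := degreeOne_of_splitsIn h2 hsplit h𝔭
  -- the Tate parametrisation of `E_K` at `𝔭` (split: `Γ_{K_𝔭}`-equivariant)
  have hsplitK : (W.baseChange K).HasSplitMultiplicativeReductionAt 𝔭 :=
    Additive.hasSplitMultiplicativeReductionAt_baseChange_of_hasSplitMultiplicativeReductionAtPrime
      W p 𝔭 h𝔭 hsplitW
  obtain ⟨q, Φ, hq0, hq1, hsurj, hkeriff, hΦσ, -⟩ :=
    TateCurve.Silverman1994_thmV53_tateUniformisation_holds (W.baseChange K) 𝔭 hsplitK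
  have hker : ∀ u : (AlgebraicClosure (𝔭.adicCompletion K))ˣ, Φ (Additive.ofMul u) = 0 →
      ∃ a : ℤ, (u : AlgebraicClosure (𝔭.adicCompletion K)) =
        algebraMap (𝔭.adicCompletion K) (AlgebraicClosure (𝔭.adicCompletion K)) q ^ a :=
    fun u h ↦ (hkeriff u).1 h
  -- the sign convention of the twisted API with `t = 1` (no twist)
  have hΨσ : ∀ (σ : absoluteGaloisGroup (𝔭.adicCompletion K))
      (u : (AlgebraicClosure (𝔭.adicCompletion K))ˣ),
      σ • Φ (Additive.ofMul u) =
        (if Field.absoluteGaloisGroup.toAlgEquiv (𝔭.adicCompletion K) σ (1 : AlgebraicClosure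
            (𝔭.adicCompletion K)) = 1 then (1 : ℤ) else -1) •
        Φ (Additive.ofMul (Units.map
          (Field.absoluteGaloisGroup.toAlgEquiv (𝔭.adicCompletion K) σ :
            AlgebraicClosure (𝔭.adicCompletion K) →* AlgebraicClosure (𝔭.adicCompletion K)) u)) := by
    intro σ u
    have h1 : Field.absoluteGaloisGroup.toAlgEquiv (𝔭.adicCompletion K) σ
        (1 : AlgebraicClosure (𝔭.adicCompletion K)) = 1 := map_one _
    rw [if_pos h1, one_zsmul]
    exact hΦσ σ u
  set C := (tateDatum (W.baseChange K) p Φ (sign_disj (W.baseChange K) Φ 1 hΨσ)).plus with hC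
  -- the numeric clauses and the character of the Tate line
  obtain ⟨hC1, hCord⟩ := tateDatum_lineClauses (W.baseChange K) p Φ 1 hΨσ hq0 hq1 hker
  -- `E_K[p^∞]^{D_𝔭}` is finite
  obtain ⟨hfinv, -⟩ := finite_and_natCard_primaryComponent_adicCompletion_eq_padic W p 𝔭 h𝔭 he hf
  haveI := hfinv
  obtain ⟨hfinD, -⟩ := natCard_fixedPoints_decomp_le_natCard_primaryComponent (W.baseChange K) p 𝔭
  haveI := hfinD
  refine localTowerTorsionFiniteAt_of_trivQuotLine (W.baseChange K) p κ 𝔭 C hC1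
    (tateDatum_smul_sub_mem_of_equivariant (W.baseChange K) p Φ _ hsurj hker hΦσ) ?_
  -- the moving element: the norm residue symbol `σ₀` of `π²/p^h`
  haveI := liesOver_span_of_natCast_mem (K := K) h𝔭
  have hdeg := ramificationIdx_mul_inertiaDeg_eq_one_of_splitsIn h2 hsplit h𝔭
  obtain ⟨h, π, hh, hπ⟩ := exists_pow_eq_span_singleton 𝔭
  obtain ⟨σ₀, hfrob, hkerκ, hcyc⟩ :=
    ZpExtension.exists_isFrobPow_mem_kerSubgroup_of_isAnticyclotomic_holds (K := K) (p := p) hK hp2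
      𝔭 h𝔭 he hf h π hh hπ
  set g := absGaloisRestrict K (𝔭.adicCompletion K) σ₀ with hg
  refine ⟨g, Subgroup.mem_inf.mpr ⟨⟨σ₀, rfl⟩, hkerκ κ hκ⟩, ?_⟩
  by_contra hfix
  push Not at hfix
  obtain ⟨s, hs1, hsc⟩ := tateDatum_lineCharacter (W.baseChange K) p Φ 1 hΨσ hq0 hq1 hker σ₀
  set εu : ℤ_[p]ˣ := GaloisRep.cyclotomicCharacter K p g with hεu
  -- Step A: `s · ε(σ₀) = 1` in `ℤ_p` (read off points of `C` of every order)
  have hsu : (s : ℤ_[p]) * (εu : ℤ_[p]) = 1 := by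
    refine (PadicInt.ext_of_toZModPow).mp fun k ↦ ?_
    obtain ⟨c, hcC, hcord⟩ := hCord k
    set N : ℕ := (PadicInt.toZModPow k ((s : ℤ_[p]) * (εu : ℤ_[p]))).val with hN
    have hNmem : (((N : ℤ) : ℤ_[p])) - s * (εu : ℤ_[p]) ∈
        (Ideal.span {(p : ℤ_[p]) ^ k} : Ideal ℤ_[p]) := by
      rw [← PadicInt.ker_toZModPow, RingHom.mem_ker, map_sub, map_intCast, Int.cast_natCast, hN,
        ZMod.natCast_zmod_val, sub_self]
    have hpk : p ^ k • c = 0 := by rw [← hcord]; exact addOrderOf_nsmul_eq_zero c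
    have h1 := hsc k c hcC hpk (N : ℤ) hNmem
    rw [hfix c hcC] at h1
    -- `c = N • c` with `c` of order `p^k`: `N ≡ 1 (mod p^k)`
    have hdvd : ((p ^ k : ℕ) : ℤ) ∣ (N : ℤ) - 1 := by
      rw [← hcord, addOrderOf_dvd_iff_zsmul_eq_zero]
      have e1 : ((N : ℤ) - 1) • c = (N : ℤ) • c - c := by
        rw [sub_smul, one_smul]
      rw [e1, ← h1, sub_self]
    have hNone : ((N : ℤ) : ZMod (p ^ k)) = 1 := by
      rw [← Int.cast_one, ZMod.intCast_eq_intCast_iff_dvd_sub]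
      rw [← Int.dvd_neg, neg_sub]
      exact hdvd
    rw [map_one, ← hNone, Int.cast_natCast, hN, ZMod.natCast_zmod_val]
  -- Step B: `ε(σ₀) φ(π)² = p^{2h}`
  have hB := mul_sq_eq_of_congruences (p := p) 𝔭 hdeg hπ hcyc
  -- Step C: `s φ(π)² = p^{2h}` in `ℤ_p`, then in `ℚ_p` — excluded by the weight
  set φ := integersToPadicInt 𝔭 p hdeg with hφ
  have hss : (s : ℤ_[p]) * s = 1 := by rcases hs1 with rfl | rfl <;> push_cast <;> norm_num
  have hCeq : (s : ℤ_[p]) * φ π ^ 2 = (p : ℤ_[p]) ^ (2 * h) := by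
    have hε : (εu : ℤ_[p]) = s := by
      calc (εu : ℤ_[p]) = (s * s) * (εu : ℤ_[p]) := by rw [hss, one_mul]
        _ = s * ((s : ℤ_[p]) * (εu : ℤ_[p])) := by ring
        _ = s := by rw [hsu, mul_one]
    rw [← hB, hε, hφ]
  have hN : Ideal.absNorm 𝔭.asIdeal = p := by
    rw [Ideal.absNorm_apply, Submodule.cardQuot_apply, ← pow_one 𝔭.asIdeal, natCard_quot_pow' 𝔭 p hdeg 1,
      pow_one]
  have hφ' : Function.Injective ((PadicInt.Coe.ringHom (p := p)).comp φ) :=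
    (Subtype.val_injective).comp (integersToPadicInt_injective 𝔭 p hdeg)
  refine ne_of_span_eq_pow (R := ℚ_[p]) h2 𝔭.isPrime hp.out hN h𝔭
    (natCast_notMem_sq 𝔭 p hdeg) hh hπ ((PadicInt.Coe.ringHom (p := p)).comp φ) hφ' hs1 ?_
  have := congrArg (fun z : ℤ_[p] ↦ (z : ℚ_[p])) hCeq
  simpa using this

end Split

end Summit.BirchSwinnertonDyer.BirchSwinnertonDyer.Theorems.CtlLoc

end
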